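import Summits.ValiantsHypothesis.ValiantsHypothesis.Theorems.KPlusLogSqLawTridiagonalRealStaticUnitRows

/-!
# Route «KPlusLogSqLaw», crux `WeakLifting` (stmt-ValiantsHypothesis-19561) — REAL side of the tridiagonal sector:
# the UNIT-COEFFICIENT sub-sector — a ONE-SIGNED design of size 11 with SIX positive zeros (the one-signed cap `⌊m/2⌋` fails at `m = 11`, kernel)

HONEST FRAMING.  Helper theorems (`--supports stmt-ValiantsHypothesis-19561 --as helper`), seat val-sym-lift-p1 (g19), cell `pub-symmetroid`,
2026-08-28; third of the one-signed witness rows (`…UnitSevenOneSignedFour` p644354: size 7, four zeros; `…UnitNineOneSignedFive`: size 9, five).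
SIZE 11: the unit design with diagonal exponents `d = (1,0,1,1,0,0,0,1,0,1,0)` and link exponents `f = (6,3,8,1,3,6,3,1,5,4)` has ALL EDGE SLOPES
POSITIVE, `L = (11, 5, 14, 1, 6, 12, 5, 1, 9, 7)`, and `D₁₁ = X⁵·Q` with the degree-46 polynomial `Q` displayed in `eval_unit_eleven_oneSigned`;
signs `+ − + − + − +` at `1/2, 3/4, 4/5, 19/20, 4/3, 3/2, 3`: at least SIX distinct positive zeros (`exists_unit_eleven_oneSigned_six_le_card`; located:
exactly six by exact Sturm — three below the resonance (the inertia floor `⌊11/3⌋`), the resonance `1` itself (`11 ≡ 2 mod 3`), and TWO ABOVE,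
a dominant-side reversal as at sizes 7 and 9).  ONE-SIGNED CAP TABLE after this file (kernel): `Z ≤ ⌊m/2⌋` holds for `m ∈ {3,4,5,6,8}`
(`…UnitMonotoneInertia`) and FAILS for `m ∈ {7, 9, 11}`; the mechanism in all three witnesses is one up–down excursion of the inertia above
the resonance, worth `⌊m/3⌋ + [m ≡ 2 mod 3] + 2` zeros, which exceeds `⌊m/2⌋` exactly for `m ∈ {7, 8, 9, 11}` (at `m = 8` the excursion is
impossible — the cap holds there); sizes `10` and `≥ 12` would need longer excursions and are not decided here.  Found by the seat's probe
tools/m10_pattern_search.py.  Nothing here is an upper law for the register (α NO MOVER); nothing bears on `WeakLifting` / `TropicalB`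
(stmt-19771) in their windows, Conjecture B, the Door-A registers, `MatrixDescartes` (stmt-18050) or VP ≠ VNP.
[this seat; folklore: continuants ↔ matchings of the path, IVT sign certificates]
-/

-- `Summit.ValiantsHypothesis.ValiantsHypothesis.…` repeats a component by the D-0017 layout (single-conjunct summit); the name is mandated.
set_option linter.dupNamespace false
set_option autoImplicit false

namespace Summit.ValiantsHypothesis.ValiantsHypothesis.Theorems.KPlusLogSqLaw
namespace StaticTridiagonalRealUnit

open Polynomial Finset
open Summit.ValiantsHypothesis.ValiantsHypothesis.Theorems.KPlusLogSqLaw.StaticTridiagonalRealPotential (pathDet)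
open Summit.ValiantsHypothesis.ValiantsHypothesis.Theorems.SymmetroidDescartes (le_card_posRoots_of_alternating)

/-- the one-signed size-`11` design `d = (1,0,1,1,0,0,0,1,0,1,0)`, `f = (6,3,8,1,3,6,3,1,5,4)` (slopes `(11,5,14,1,6,12,5,1,9,7)`):
`D₁₁ = X⁵·Q`, `deg Q = 46`. [this file] -/
theorem eval_unit_eleven_oneSigned (x : ℝ) :
    (pathDet (fun _ => (1 : ℝ)) (fun t => if t = 0 ∨ t = 2 ∨ t = 3 ∨ t = 7 ∨ t = 9 then 1 else 0) (fun _ => (1 : ℝ))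
        (fun t => if t = 0 then 6 else if t = 1 then 3 else if t = 2 then 8 else if t = 3 then 1 else if t = 4 then 3 else if t = 5 then 6
          else if t = 6 then 3 else if t = 7 then 1 else if t = 8 then 5 else 4) 11).eval x =
      x ^ 5 * (1 - 2 * x + x ^ 2 - 2 * x ^ 5 + 2 * x ^ 6 - x ^ 7 + 2 * x ^ 8 - 2 * x ^ 9 + 2 * x ^ 10 + 2 * x ^ 12 - x ^ 13 - 3 * x ^ 18 + x ^ 19
        + x ^ 21 - 3 * x ^ 22 + 2 * x ^ 23 - 3 * x ^ 24 + 4 * x ^ 25 - 3 * x ^ 26 - x ^ 27 - 2 * x ^ 30 + 2 * x ^ 31 - x ^ 32 + x ^ 33 + x ^ 34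
        - x ^ 35 + x ^ 36 + 2 * x ^ 38 + x ^ 40 - x ^ 43 + x ^ 44 - 2 * x ^ 45 + x ^ 46) := by
  obtain ⟨e0, e1⟩ := eval_unit_zero_one (fun t => if t = 0 ∨ t = 2 ∨ t = 3 ∨ t = 7 ∨ t = 9 then 1 else 0)
    (fun t => if t = 0 then 6 else if t = 1 then 3 else if t = 2 then 8 else if t = 3 then 1 else if t = 4 then 3 else if t = 5 then 6
          else if t = 6 then 3 else if t = 7 then 1 else if t = 8 then 5 else 4) x
  have e := fun n => eval_unit_add_two (fun t => if t = 0 ∨ t = 2 ∨ t = 3 ∨ t = 7 ∨ t = 9 then 1 else 0)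
    (fun t => if t = 0 then 6 else if t = 1 then 3 else if t = 2 then 8 else if t = 3 then 1 else if t = 4 then 3 else if t = 5 then 6
          else if t = 6 then 3 else if t = 7 then 1 else if t = 8 then 5 else 4) x n
  have e2 := e 0
  have e3 := e 1
  have e4 := e 2
  have e5 := e 3
  have e6 := e 4
  have e7 := e 5
  have e8 := e 6
  have e9 := e 7
  have e10 := e 8
  have e11 := e 9
  simp only [zero_add] at e2
  rw [e11, e10, e9, e8, e7, e6, e5, e4, e3, e2, e1, e0]
  norm_num
  ring

/-- the slopes of the design are all positive: `d_k + d_{k+1} < 2f_k` for `k < 10`. [this file] -/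
theorem slopes_pos_unit_eleven_oneSigned :
    ∀ k, k + 1 < 11 → (fun t : ℕ => if t = 0 ∨ t = 2 ∨ t = 3 ∨ t = 7 ∨ t = 9 then 1 else 0) k
        + (fun t : ℕ => if t = 0 ∨ t = 2 ∨ t = 3 ∨ t = 7 ∨ t = 9 then 1 else 0) (k + 1) <
      2 * (fun t : ℕ => if t = 0 then 6 else if t = 1 then 3 else if t = 2 then 8 else if t = 3 then 1 else if t = 4 then 3 else if t = 5 then 6
          else if t = 6 then 3 else if t = 7 then 1 else if t = 8 then 5 else 4) k := by
  intro k hk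
  have : k = 0 ∨ k = 1 ∨ k = 2 ∨ k = 3 ∨ k = 4 ∨ k = 5 ∨ k = 6 ∨ k = 7 ∨ k = 8 ∨ k = 9 := by omega
  rcases this with rfl | rfl | rfl | rfl | rfl | rfl | rfl | rfl | rfl | rfl <;> simp

/-- **A ONE-SIGNED SIZE-11 UNIT DESIGN WITH SIX POSITIVE ZEROS**: there is a unit-coefficient static symmetric tridiagonal design of size `11` with
ALL edge slopes positive and at least six distinct positive determinant zeros (signs `+ − + − + − +` at `1/2, 3/4, 4/5, 19/20, 4/3, 3/2, 3`) — the
one-signed cap `Z ≤ ⌊m/2⌋` fails at `m = 11` (kernel; at `7` and `9` by the sibling files). [this file] -/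
theorem exists_unit_eleven_oneSigned_six_le_card :
    ∃ d f : ℕ → ℕ, (∀ k, k + 1 < 11 → d k + d (k + 1) < 2 * f k) ∧
      6 ≤ ((pathDet (fun _ => (1 : ℝ)) d (fun _ => (1 : ℝ)) f 11).roots.toFinset.filter (fun x => 0 < x)).card := by
  refine ⟨fun t => if t = 0 ∨ t = 2 ∨ t = 3 ∨ t = 7 ∨ t = 9 then 1 else 0,
    fun t => if t = 0 then 6 else if t = 1 then 3 else if t = 2 then 8 else if t = 3 then 1 else if t = 4 then 3 else if t = 5 then 6
          else if t = 6 then 3 else if t = 7 then 1 else if t = 8 then 5 else 4,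
    slopes_pos_unit_eleven_oneSigned, le_card_posRoots_of_alternating _ 6 (![1 / 2, 3 / 4, 4 / 5, 19 / 20, 4 / 3, 3 / 2, 3] : Fin 7 → ℝ) ?_ ?_ ?_⟩
  · refine Fin.strictMono_iff_lt_succ.2 fun j => ?_
    fin_cases j <;> norm_num [Matrix.cons_val_two, Matrix.tail_cons, Matrix.head_cons]
  · intro j; fin_cases j <;> norm_num [Matrix.cons_val_two, Matrix.tail_cons, Matrix.head_cons]
  · intro j; fin_cases j <;> norm_num [Matrix.cons_val_two, Matrix.tail_cons, Matrix.head_cons, eval_unit_eleven_oneSigned]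

end StaticTridiagonalRealUnit
end Summit.ValiantsHypothesis.ValiantsHypothesis.Theorems.KPlusLogSqLaw
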